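import Literature.Geometry.Riemannian.ConjugateHeatKernelContinuity
import Literature.Geometry.Riemannian.HeatKernelFullSupport
import Literature.Geometry.Riemannian.HeatKernelDuality
import Literature.Geometry.Riemannian.ConjugateHeatPositivity
import HarnessLib

/-!
# The conjugate heat kernel of a Ricci flow on a closed connected manifold is strictly positive
# (Bamler 2020a, §2.3: `K(x,t;y,s) > 0` for `s < t`)

R. Bamler, *Entropy and heat kernel bounds on a Ricci flow background*, arXiv:2008.07093 (2020a),
§2.3 uses throughout that the heat kernel `K(x,t;y,s)`, `s < t`, of a Ricci flow on a closed
manifold is a positive smooth function. The tree has the kernels as a family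
`K x = K(x,t;·,·)` of smooth nonnegative densities of the heat kernel measures `ν_{x,t;s}`, jointly
continuous in `(x, y, s)` (`IsRicciFlow.exists_conjugateHeatKernel_family`,
`ConjugateHeatKernelContinuity.lean`). This file proves STRICT positivity without a parabolic
strong maximum principle:

* `IsRicciFlow.exists_isConjugateHeatSolutionOn_pos` — on `[s, t]` there is a conjugate heat
  solution `v > 0` with `v(t) = 1` (Topping 2006, §6.4, translated in time).
* `bind_heatKernelMeasure_eq_withDensity_integral` — mixing the kernel measures `ν_{z,r;s}` over a
  finite measure `μ(dz)` gives the density `y ↦ ∫ K z (y, s) dμ(z)` (Tonelli).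
* `IsRicciFlow.eq_integral_conjugateHeatKernel_family` — `v(s, y) = ∫ K z (y, s) dV_{h(r)}(z)`
  for EVERY `y` (duality `IsRicciFlow.bind_heatKernelMeasure_withDensity_eq` + continuity).
* `conjugateHeatKernel_family_reproduction` — `K x (y, s) = ∫ K' z (y, s) dν_{x,t;r}(z)` for
  density families `K` (base time `t`) and `K'` (base time `r ∈ (s, t)`), pointwise.
* `IsRicciFlow.conjugateHeatKernel_family_pos` — `K x (y, s) > 0` on `M × (a, t)`: if
  `K x (y₀, s₀) = 0` then, by reproduction through an intermediate time `r` and continuity,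
  `∫ K' z (y₀, s₀) dν_{x,t;r}(z) = 0` for the kernels `K'` based at time `r`; as `ν_{x,t;r}` charges
  every nonempty open set (`IsRicciFlow.heatKernelMeasure_pos_of_isOpen`) and `K' ≥ 0` is
  continuous in `z`, `K' z (y₀, s₀) = 0` for all `z`, whence `v(s₀, y₀) = 0`, contradicting `v > 0`.
* `IsRicciFlow.exists_conjugateHeatKernel_family_pos` — the family of
  `exists_conjugateHeatKernel_family` with positivity added.

Everything is proved; no definitions, no named facts.

## References

* R. H. Bamler, *Entropy and heat kernel bounds on a Ricci flow background*, arXiv:2008.07093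
  (2020), §2.3. [Bamler2020Entropy]
* P. Topping, *Lectures on the Ricci flow*, LMS Lecture Note Series 325 (2006), §6.4. [Topping2006]
-/

noncomputable section

open Bundle Set Function Filter Manifold MeasureTheory Measure TopologicalSpace
open scoped Manifold ContDiff Topology ENNReal NNReal

namespace Literature.Geometry.Riemannian

open Lorentzian Lorentzian.PseudoRiemannianMetric

section Positivity

variable {m : ℕ} {H : Type*} [TopologicalSpace H]
  {I : ModelWithCorners ℝ (EuclideanSpace ℝ (Fin m)) H} [I.Boundaryless]
  {M : Type*} [TopologicalSpace M] [ChartedSpace H M] [IsManifold I ∞ M]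
  [T2Space M] [CompactSpace M] [SecondCountableTopology M] [MeasurableSpace M] [BorelSpace M]
  {h : ℝ → PseudoRiemannianMetric I ∞ (EuclideanSpace ℝ (Fin m)) (TangentSpace I : M → Type _)}
  {cov : ℝ → CovariantDerivative I (EuclideanSpace ℝ (Fin m)) (TangentSpace I : M → Type _)}
  (hh : IsContMDiffFamilyOn ∞ h univ) (hR : ∀ r, (h r).IsRiemannian)

/-- **A positive conjugate heat solution with final value `1`** (Topping 2006, §6.4 with
Cor. 3.1.2, translated in time): along a Ricci flow of Riemannian metrics on `[s, t]`, `s < t`, on a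
closed manifold there is a smooth solution `v` of `□* v = 0` on `M × [s, t]` with `v(t) = 1` and
`v > 0` on `M × [s, t]`. [cite: Topping2006, §6.4 and Cor. 3.1.2 (p. 35)] -/
theorem IsRicciFlow.exists_isConjugateHeatSolutionOn_pos {s t : ℝ}
    (hflow : IsRicciFlow h cov (Icc s t)) (hst : s < t) (hR : ∀ r ∈ Icc s t, (h r).IsRiemannian) :
    ∃ v : ℝ → M → ℝ, v t = (fun _ ↦ 1) ∧ IsConjugateHeatSolutionOn h cov (Icc s t) v ∧
      ∀ r ∈ Icc s t, ∀ y, 0 < v r y := by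
  have hT : 0 < t - s := sub_pos.2 hst
  have hflow' : IsRicciFlow (fun r ↦ h (r + s)) (fun r ↦ cov (r + s)) (Icc 0 (t - s)) := by
    refine (hflow.comp_add_const s).mono fun r hr ↦ ?_
    exact ⟨by linarith [hr.1], by linarith [hr.2]⟩
  have hR' : ∀ r ∈ Icc (0 : ℝ) (t - s), (h (r + s)).IsRiemannian := fun r hr ↦
    hR (r + s) ⟨by linarith [hr.1], by linarith [hr.2]⟩
  obtain ⟨u, huT, hu⟩ := hflow'.exists_isConjugateHeatSolutionOn_Icc hT hR' (fun _ ↦ (1 : ℝ))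
    contMDiff_const
  have hupos : ∀ r ∈ Icc (0 : ℝ) (t - s), ∀ y, 0 < u r y :=
    hflow'.pos_of_isConjugateHeatSolutionOn hT hR' hu fun y ↦ by rw [huT]; exact one_pos
  have hv : IsConjugateHeatSolutionOn h cov (Icc s t) fun r ↦ u (r - s) := by
    have key := hu.comp_sub_const (h := h) (cov := cov) hT
    simp only [zero_add, sub_add_cancel] at key
    exact key
  exact ⟨fun r ↦ u (r - s), huT, hv, fun r hr y ↦
    hupos (r - s) ⟨by linarith [hr.1], by linarith [hr.2]⟩ y⟩

include hh hR in
/-- **Mixing kernel densities** (Tonelli): if `ν_{z,r;s} = K z (·, s) dV_{h(s)}` for all `z`, with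
`(z, y, s) ↦ K z (y, s)` continuous and `≥ 0` on `M × (M × (a, r))`, then for every finite Borel
measure `μ` on `M` and `s ∈ (a, r)`,
`∫ ν_{z,r;s} dμ(z) = (y ↦ ∫ K z (y, s) dμ(z)) dV_{h(s)}`. [cite: Bamler2020Entropy, §2.3] -/
theorem bind_heatKernelMeasure_eq_withDensity_integral {a r : ℝ} {K : M → M × ℝ → ℝ}
    (hKν : ∀ z, ∀ s ∈ Ioo a r, heatKernelMeasure hh hR r z s =
      (h s).riemVolume.withDensity fun y ↦ ENNReal.ofReal (K z (y, s)))
    (hK0 : ∀ z, ∀ p ∈ univ ×ˢ Ioo a r, 0 ≤ K z p)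
    (hKc : ContinuousOn (fun q : M × (M × ℝ) ↦ K q.1 q.2) (univ ×ˢ (univ ×ˢ Ioo a r)))
    (μ : Measure M) [IsFiniteMeasure μ] {s : ℝ} (hs : s ∈ Ioo a r) :
    μ.bind (fun z ↦ heatKernelMeasure hh hR r z s) =
      (h s).riemVolume.withDensity fun y ↦ ENNReal.ofReal (∫ z, K z (y, s) ∂μ) := by
  haveI : IsFiniteMeasure (h s).riemVolume := ⟨(h s).riemVolume_univ_lt_top⟩
  have hc2 : Continuous fun q : M × M ↦ K q.1 (q.2, s) :=
    hKc.comp_continuous (continuous_fst.prodMk (continuous_snd.prodMk continuous_const))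
      fun q ↦ ⟨mem_univ _, mem_univ _, hs⟩
  ext A hA
  rw [Measure.bind_apply hA (measurable_heatKernelMeasure hh hR r s).aemeasurable,
    withDensity_apply _ hA]
  have e : ∀ z, heatKernelMeasure hh hR r z s A =
      ∫⁻ y in A, ENNReal.ofReal (K z (y, s)) ∂(h s).riemVolume := fun z ↦ by
    rw [hKν z s hs, withDensity_apply _ hA]
  simp_rw [e]
  have hmeas : AEMeasurable (uncurry fun z y ↦ ENNReal.ofReal (K z (y, s)))
      (μ.prod ((h s).riemVolume.restrict A)) :=
    (ENNReal.measurable_ofReal.comp hc2.measurable).aemeasurable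
  rw [lintegral_lintegral_swap hmeas]
  refine lintegral_congr fun y ↦ ?_
  have hcy : Continuous fun z ↦ K z (y, s) := hc2.comp (continuous_id.prodMk continuous_const)
  have hint : Integrable (fun z ↦ K z (y, s)) μ :=
    hcy.integrable_of_hasCompactSupport (HasCompactSupport.of_compactSpace _)
  exact (ofReal_integral_eq_lintegral_ofReal hint
    (Eventually.of_forall fun z ↦ hK0 z _ ⟨mem_univ _, hs⟩)).symm

omit [I.Boundaryless] in
/-- The mixed density `y ↦ ∫ K z (y, s) dμ(z)` of
`bind_heatKernelMeasure_eq_withDensity_integral` is continuous (parametric integral of a jointly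
continuous integrand over a compact space). [folklore] -/
theorem continuous_integral_conjugateHeatKernel_family {a r : ℝ} {K : M → M × ℝ → ℝ}
    (hKc : ContinuousOn (fun q : M × (M × ℝ) ↦ K q.1 q.2) (univ ×ˢ (univ ×ˢ Ioo a r)))
    (μ : Measure M) [IsFiniteMeasure μ] {s : ℝ} (hs : s ∈ Ioo a r) :
    Continuous fun y ↦ ∫ z, K z (y, s) ∂μ := by
  -- `M` is compact Hausdorff second countable, hence metrizable and first countable
  haveI : MetrizableSpace M := TopologicalSpace.metrizableSpace_of_t3_secondCountable M
  have hc2 : Continuous fun q : M × M ↦ K q.2 (q.1, s) :=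
    hKc.comp_continuous (continuous_snd.prodMk (continuous_fst.prodMk continuous_const))
      fun q ↦ ⟨mem_univ _, mem_univ _, hs⟩
  have := continuous_parametric_integral_of_continuous (μ := μ)
    (f := fun y z ↦ K z (y, s)) hc2 isCompact_univ
  simpa only [Measure.restrict_univ] using this

omit [I.Boundaryless] [T2Space M] [CompactSpace M] [SecondCountableTopology M] [MeasurableSpace M]
  [BorelSpace M] in
/-- A slice `y ↦ K x (y, s)` of a function jointly continuous on `M × (M × (a, r))` is continuous
(`s ∈ (a, r)`). [folklore] -/
theorem slice_continuous_of_continuousOn {a r : ℝ} {K : M → M × ℝ → ℝ}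
    (hKc : ContinuousOn (fun q : M × (M × ℝ) ↦ K q.1 q.2) (univ ×ˢ (univ ×ˢ Ioo a r)))
    (x : M) {s : ℝ} (hs : s ∈ Ioo a r) : Continuous fun y ↦ K x (y, s) :=
  hKc.comp_continuous (continuous_const.prodMk (continuous_id.prodMk continuous_const))
    fun _ ↦ ⟨mem_univ _, mem_univ _, hs⟩

include hh hR in
/-- **The averaged kernel is the positive conjugate solution, pointwise**: for a Ricci flow on
`[a, r]`, kernels `K z = K(z,r;·,·)` as in `bind_heatKernelMeasure_eq_withDensity_integral`,
`s ∈ (a, r)` and a conjugate heat solution `v ≥ 0` on `[s, r]` with `v(r) = 1`,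
`v(s, y) = ∫ K z (y, s) dV_{h(r)}(z)` for EVERY `y ∈ M` (the averaged identity
`IsRicciFlow.bind_heatKernelMeasure_withDensity_eq` identifies the two continuous densities
`dV_{h(s)}`-a.e., hence everywhere). [cite: Bamler2020Entropy, §2.3] -/
theorem IsRicciFlow.eq_integral_conjugateHeatKernel_family {a r : ℝ}
    (hflow : IsRicciFlow h cov (Icc a r)) {K : M → M × ℝ → ℝ}
    (hKν : ∀ z, ∀ s ∈ Ioo a r, heatKernelMeasure hh hR r z s =
      (h s).riemVolume.withDensity fun y ↦ ENNReal.ofReal (K z (y, s)))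
    (hK0 : ∀ z, ∀ p ∈ univ ×ˢ Ioo a r, 0 ≤ K z p)
    (hKc : ContinuousOn (fun q : M × (M × ℝ) ↦ K q.1 q.2) (univ ×ˢ (univ ×ˢ Ioo a r)))
    {s : ℝ} (hs : s ∈ Ioo a r) {v : ℝ → M → ℝ} (hv : IsConjugateHeatSolutionOn h cov (Icc s r) v)
    (hvr : v r = fun _ ↦ 1) (hv0 : ∀ r' ∈ Icc s r, ∀ y, 0 ≤ v r' y) (y : M) :
    v s y = ∫ z, K z (y, s) ∂(h r).riemVolume := by
  haveI : IsFiniteMeasure (h r).riemVolume := ⟨(h r).riemVolume_univ_lt_top⟩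
  haveI : IsFiniteMeasure (h s).riemVolume := ⟨(h s).riemVolume_univ_lt_top⟩
  have hflow' : IsRicciFlow h cov (Icc s r) := hflow.mono (Icc_subset_Icc hs.1.le le_rfl)
  have key := hflow'.bind_heatKernelMeasure_withDensity_eq hh hR hs.2 contMDiff_const
    (fun _ ↦ zero_le_one) hv hvr hv0
  simp only [ENNReal.ofReal_one] at key
  rw [show (fun _ : M ↦ (1 : ℝ≥0∞)) = 1 from rfl, withDensity_one,
    bind_heatKernelMeasure_eq_withDensity_integral hh hR hKν hK0 hKc _ hs] at key
  -- the two continuous densities agree a.e., hence everywhere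
  set F : M → ℝ := fun y ↦ ∫ z, K z (y, s) ∂(h r).riemVolume with hF
  have hFc : Continuous F := continuous_integral_conjugateHeatKernel_family hKc _ hs
  have hF0 : ∀ y, 0 ≤ F y := fun y ↦ integral_nonneg fun z ↦ hK0 z _ ⟨mem_univ _, hs⟩
  have hvc : Continuous (v s) := (contMDiff_slice_of_contMDiffOn hv.1 ⟨le_rfl, hs.2.le⟩).continuous
  have hFi : Integrable F (h s).riemVolume :=
    hFc.integrable_of_hasCompactSupport (HasCompactSupport.of_compactSpace _)
  have hFfin : ∫⁻ y, ENNReal.ofReal (F y) ∂(h s).riemVolume ≠ ⊤ := by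
    rw [← ofReal_integral_eq_lintegral_ofReal hFi (Eventually.of_forall hF0)]
    exact ENNReal.ofReal_ne_top
  have hae := (withDensity_eq_iff (ENNReal.measurable_ofReal.comp hFc.measurable).aemeasurable
    (ENNReal.measurable_ofReal.comp hvc.measurable).aemeasurable hFfin).1 key
  have hae' : F =ᵐ[(h s).riemVolume] v s := hae.mono fun y hy ↦ by
    have hy' : ENNReal.ofReal (F y) = ENNReal.ofReal (v s y) := hy
    rwa [ENNReal.ofReal_eq_ofReal_iff (hF0 y) (hv0 s ⟨le_rfl, hs.2.le⟩ y)] at hy'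
  haveI : (h s).riemVolume.IsOpenPosMeasure := by
    rw [riemVolume_eq (hR s)]
    exact isOpenPosMeasure_riemannianMeasure _
  exact (congrFun (Measure.eq_of_ae_eq hae' hFc hvc) y).symm

include hh hR in
/-- **Reproduction formula for the kernel densities, pointwise** (Bamler 2020a, §2.3, the
semigroup property `K(x,t;y,s) = ∫ K(x,t;z,r) K(z,r;y,s) dg_r(z)` in the form
`K(x,t;y,s) = ∫ K(z,r;y,s) dν_{x,t;r}(z)`): for `s < r < t`, nonnegative jointly continuous density
families `K` (base time `t`, on `M × (a, t)`) and `K'` (base time `r`, on `M × (a, r)`) of the heat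
kernel measures, `K x (y, s) = ∫ K' z (y, s) dν_{x,t;r}(z)` for EVERY `y` (reproduction
`bind_heatKernelMeasure`, the mixed density `bind_heatKernelMeasure_eq_withDensity_integral`, and
continuity of both densities). [cite: Bamler2020Entropy, §2.3] -/
theorem conjugateHeatKernel_family_reproduction {a r t : ℝ} (hrt : r < t) {K : M → M × ℝ → ℝ}
    (hK0 : ∀ x, ∀ p ∈ univ ×ˢ Ioo a t, 0 ≤ K x p)
    (hKν : ∀ x, ∀ s ∈ Ioo a t, heatKernelMeasure hh hR t x s =
      (h s).riemVolume.withDensity fun y ↦ ENNReal.ofReal (K x (y, s)))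
    (hKc : ContinuousOn (fun q : M × (M × ℝ) ↦ K q.1 q.2) (univ ×ˢ (univ ×ˢ Ioo a t)))
    {K' : M → M × ℝ → ℝ} (hK'0 : ∀ z, ∀ p ∈ univ ×ˢ Ioo a r, 0 ≤ K' z p)
    (hK'ν : ∀ z, ∀ s ∈ Ioo a r, heatKernelMeasure hh hR r z s =
      (h s).riemVolume.withDensity fun y ↦ ENNReal.ofReal (K' z (y, s)))
    (hK'c : ContinuousOn (fun q : M × (M × ℝ) ↦ K' q.1 q.2) (univ ×ˢ (univ ×ˢ Ioo a r)))
    (x : M) {s : ℝ} (hs : s ∈ Ioo a r) (y : M) :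
    K x (y, s) = ∫ z, K' z (y, s) ∂(heatKernelMeasure hh hR t x r) := by
  have hst : s ∈ Ioo a t := ⟨hs.1, hs.2.trans hrt⟩
  set μ : Measure M := heatKernelMeasure hh hR t x r with hμ
  have hrep := bind_heatKernelMeasure hh hR hs.2.le hrt.le x (s := s)
  rw [bind_heatKernelMeasure_eq_withDensity_integral hh hR hK'ν hK'0 hK'c μ hs,
    hKν x s hst] at hrep
  haveI : IsFiniteMeasure (h s).riemVolume := ⟨(h s).riemVolume_univ_lt_top⟩
  set G : M → ℝ := fun y ↦ ∫ z, K' z (y, s) ∂μ with hG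
  have hGc : Continuous G := continuous_integral_conjugateHeatKernel_family hK'c μ hs
  have hG0 : ∀ y, 0 ≤ G y := fun y ↦ integral_nonneg fun z ↦ hK'0 z _ ⟨mem_univ _, hs⟩
  have hKxc : Continuous fun y ↦ K x (y, s) := slice_continuous_of_continuousOn hKc x hst
  have hGi : Integrable G (h s).riemVolume :=
    hGc.integrable_of_hasCompactSupport (HasCompactSupport.of_compactSpace _)
  have hGfin : ∫⁻ y, ENNReal.ofReal (G y) ∂(h s).riemVolume ≠ ⊤ := by
    rw [← ofReal_integral_eq_lintegral_ofReal hGi (Eventually.of_forall hG0)]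
    exact ENNReal.ofReal_ne_top
  have hae := (withDensity_eq_iff (ENNReal.measurable_ofReal.comp hGc.measurable).aemeasurable
    (ENNReal.measurable_ofReal.comp hKxc.measurable).aemeasurable hGfin).1 hrep
  have hae' : G =ᵐ[(h s).riemVolume] fun y ↦ K x (y, s) := hae.mono fun y hy ↦ by
    have hy' : ENNReal.ofReal (G y) = ENNReal.ofReal (K x (y, s)) := hy
    show G y = K x (y, s)
    rwa [ENNReal.ofReal_eq_ofReal_iff (hG0 y) (hK0 x _ ⟨mem_univ _, hst⟩)] at hy'
  haveI : (h s).riemVolume.IsOpenPosMeasure := by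
    rw [riemVolume_eq (hR s)]
    exact isOpenPosMeasure_riemannianMeasure _
  exact (congrFun (Measure.eq_of_ae_eq hae' hGc hKxc) y).symm

include hh hR in
/-- **Strict positivity of the conjugate heat kernels** (Bamler 2020a, §2.3: `K(x,t;y,s) > 0`): on a
closed connected `M`, for a `C^∞` family `h` of Riemannian metrics which is a Ricci flow on
`[a, t]`, `a < t`, any family `K x`, `x ∈ M`, of nonnegative densities of the heat kernel measures
(`ν_{x,t;s} = K x (·, s) dV_{h(s)}`, `s ∈ (a, t)`) which is jointly continuous on
`M × (M × (a, t))` is strictly positive there. Proof without the strong maximum principle: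
reproduction through `r ∈ (s₀, t)` (`conjugateHeatKernel_family_reproduction`), full support of
`ν_{x,t;r}` (`IsRicciFlow.heatKernelMeasure_pos_of_isOpen`) and the positive averaged solution
(`IsRicciFlow.eq_integral_conjugateHeatKernel_family`). [cite: Bamler2020Entropy, §2.3] -/
theorem IsRicciFlow.conjugateHeatKernel_family_pos [PreconnectedSpace M] {a t : ℝ} (hat : a < t)
    (hflow : IsRicciFlow h cov (Icc a t)) {K : M → M × ℝ → ℝ}
    (hK0 : ∀ x, ∀ p ∈ univ ×ˢ Ioo a t, 0 ≤ K x p)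
    (hKν : ∀ x, ∀ s ∈ Ioo a t, heatKernelMeasure hh hR t x s =
      (h s).riemVolume.withDensity fun y ↦ ENNReal.ofReal (K x (y, s)))
    (hKc : ContinuousOn (fun q : M × (M × ℝ) ↦ K q.1 q.2) (univ ×ˢ (univ ×ˢ Ioo a t)))
    (x : M) {p : M × ℝ} (hp : p ∈ univ ×ˢ Ioo a t) : 0 < K x p := by
  have _ := hat
  obtain ⟨y₀, s₀⟩ := p
  have hs₀ : s₀ ∈ Ioo a t := hp.2
  by_contra hle
  have h0 : K x (y₀, s₀) = 0 := le_antisymm (not_lt.1 hle) (hK0 x _ hp)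
  -- an intermediate time `r` and the kernels based at time `r`
  set r : ℝ := (s₀ + t) / 2 with hr
  have hs₀r : s₀ < r := by rw [hr]; linarith [hs₀.2]
  have hrt : r < t := by rw [hr]; linarith [hs₀.2]
  have har : a < r := hs₀.1.trans hs₀r
  have hflowr : IsRicciFlow h cov (Icc a r) := hflow.mono (Icc_subset_Icc le_rfl hrt.le)
  obtain ⟨K', -, hK'0, hK'ν, -, -, hK'c⟩ := hflowr.exists_conjugateHeatKernel_family hh hR har
  have hs₀' : s₀ ∈ Ioo a r := ⟨hs₀.1, hs₀r⟩
  set μ : Measure M := heatKernelMeasure hh hR t x r with hμ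
  -- reproduction: `0 = K x (y₀, s₀) = ∫ K' z (y₀, s₀) dν_{x,t;r}(z)`
  have hG00 : ∫ z, K' z (y₀, s₀) ∂μ = 0 := by
    rw [← conjugateHeatKernel_family_reproduction hh hR hrt hK0 hKν hKc hK'0 hK'ν hK'c x hs₀' y₀, h0]
  -- `ν_{x,t;r}` charges nonempty open sets, so `K' z (y₀, s₀) = 0` for all `z`
  haveI : μ.IsOpenPosMeasure := ⟨fun U hU hne ↦
    ((hflow.mono (Icc_subset_Icc har.le le_rfl)).heatKernelMeasure_pos_of_isOpen hh hR hrt hU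
      hne x).ne'⟩
  have hK'zc : Continuous fun z ↦ K' z (y₀, s₀) :=
    hK'c.comp_continuous (continuous_id.prodMk continuous_const)
      fun _ ↦ ⟨mem_univ _, mem_univ _, hs₀'⟩
  have hK'zi : Integrable (fun z ↦ K' z (y₀, s₀)) μ :=
    hK'zc.integrable_of_hasCompactSupport (HasCompactSupport.of_compactSpace _)
  have hzero : (fun z ↦ K' z (y₀, s₀)) = fun _ ↦ 0 := by
    have h1 := (integral_eq_zero_iff_of_nonneg (fun z ↦ hK'0 z _ ⟨mem_univ _, hs₀'⟩) hK'zi).1 hG00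
    exact Measure.eq_of_ae_eq h1 hK'zc continuous_const
  -- the positive conjugate solution on `[s₀, r]` with final value `1` vanishes at `(y₀, s₀)`
  obtain ⟨v, hvr, hv, hvpos⟩ := (hflow.mono (Icc_subset_Icc hs₀.1.le hrt.le)
    ).exists_isConjugateHeatSolutionOn_pos hs₀r fun r' _ ↦ hR r'
  have hvy := hflowr.eq_integral_conjugateHeatKernel_family hh hR hK'ν hK'0 hK'c hs₀' hv hvr
    (fun r' hr' y ↦ (hvpos r' hr' y).le) y₀
  rw [hzero, integral_zero] at hvy
  exact (hvpos s₀ ⟨le_rfl, hs₀r.le⟩ y₀).ne' hvy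

include hh hR in
/-- **The conjugate heat kernels of a Ricci flow on a closed connected manifold: smooth, strictly
positive, Lipschitz in the base point and jointly continuous** — the family of
`IsRicciFlow.exists_conjugateHeatKernel_family` with strict positivity
(`IsRicciFlow.conjugateHeatKernel_family_pos`). [cite: Bamler2020Entropy, §2.3] -/
theorem IsRicciFlow.exists_conjugateHeatKernel_family_pos [PreconnectedSpace M] {a t : ℝ}
    (hat : a < t) (hflow : IsRicciFlow h cov (Icc a t)) :
    ∃ K : M → M × ℝ → ℝ,
      (∀ x, ContMDiffOn (I.prod 𝓘(ℝ, ℝ)) 𝓘(ℝ, ℝ) ∞ (K x) (univ ×ˢ Ioo a t)) ∧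
      (∀ x, ∀ p ∈ univ ×ˢ Ioo a t, 0 < K x p) ∧
      (∀ x, ∀ s ∈ Ioo a t, heatKernelMeasure hh hR t x s =
        (h s).riemVolume.withDensity fun y ↦ ENNReal.ofReal (K x (y, s))) ∧
      (∀ x, ∀ p ∈ univ ×ˢ Ioo a t, deriv (fun s ↦ K x (p.1, s)) p.2 =
        -(h p.2).laplaceBeltrami (fun y ↦ K x (y, p.2)) p.1 +
          (h p.2).scalarCurvatureWith (cov p.2) p.1 * K x p) ∧
      (∀ a' b', a < a' → a' < b' → b' < t → ∃ L : ℝ, ∀ (x x' : M), ∀ p ∈ univ ×ˢ Icc a' b',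
        ENNReal.ofReal |K x p - K x' p| ≤ ENNReal.ofReal L * (h t).edist (hR t) x x') ∧
      ContinuousOn (fun q : M × (M × ℝ) ↦ K q.1 q.2) (univ ×ˢ (univ ×ˢ Ioo a t)) := by
  obtain ⟨K, hKs, hK0, hKν, hKpde, hLip, hKc⟩ := hflow.exists_conjugateHeatKernel_family hh hR hat
  exact ⟨K, hKs, fun x _ hp ↦ hflow.conjugateHeatKernel_family_pos hh hR hat hK0 hKν hKc x hp,
    hKν, hKpde, hLip, hKc⟩

end Positivity

end Literature.Geometry.Riemannian

end
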